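import Summits.BirchSwinnertonDyer.Rank1Residual.P2.CongruentNumberThetaThreePrimesFamiliesAoki
import Summits.BirchSwinnertonDyer.Rank1Residual.P2.CongruentNumberPairsAtTwoEvenDoorDescent
import HarnessLib

/-!
# Cell «bsd-monsky» (prover-B): the five explicit `k = 3` families of route B — types `(5,5,7)`, `(3,7,7)`, `(3,5,5)`, `(1,5,7)`,
# `(1,3,5)` — WITHOUT any `2`-Selmer display: `ord_{s=1} L = 1`, rank `1`, `Ш[2^∞] = 0`, `BSD(E_n, 2)` relative to
# {`tyz_cmPointGaloisData`, TYZ Thm. 1.1, GZK} ONLY (kernel theorems; nothing asserted)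

HONEST FRAMING (cell `bsd-monsky`, run/shared/lean/pub/bsd-monsky/; README §1/§3): the cell's CLAIMED theorem is Monsky's 1990
conjecture (a)+(b) on `𝒮⁻` (`k = 2`); «ℓ ≥ 3 rungs (C-P2-2 for k ≥ 3) are NOT claimed — record what the same argument gives there, no
more». The `k = 3` RECORD (paper Remark 5.2 / §6 (F7)) landed twice: on Monsky's even matrix theorem `hMe`
(`P2/CongruentNumberThetaThreePrimes{,B,C,D,E}Family.lean`) and on Aoki's Thm. 2.2 `hAo` (`…FamiliesAoki.lean`) — the `2`-Selmer
input `#Sel₂(E_n) = 8` (`s(n) = 1`) being a DISPLAYED published fact either way. The tree now PROVES Monsky's even formula's upper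
bound `#Sel₂(E_{2p₁⋯p_k}) ≤ 2^{2+s}` for every `k` (`Literature/…/CongruentNumberEvenMonskySelmerBound.lean`, complete `2`-descent
on Selmer classes) and the `(p, q, r)` door modulo GZK only (`rankOne_sha_bsdp_two_iff_congruentNumberCurve_two_mul_pqr_descent`,
`P2/CongruentNumberPairsAtTwoEvenDoorDescent.lean`). THIS FILE swaps that door into the five family theorems: each holds relative to
{`tyz_cmPointGaloisData`, `thm11_parity_of_scriptL` (idle for `(5,5,7)`), `rank_eq_analyticRank_of_analyticRank_le_one`} ONLY —
the CM/genus-point display, TYZ's Theorem 1.1 and Gross–Zagier–Kolyvagin; no Monsky 1990 / HB94 / Aoki binder (`s(n) = 1` itself was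
always kernel-decided on each type: `monskySelmerRankEven_557/377/355/157/135`). The rank-one data are the record's
(`rankOneDatum_two_mul_557_of_cmPointGaloisData`, `rankOneDatum_two_mul_377`, `…_355`, `…_157`, `…_135`). CONDITIONAL on the three
named facts; nothing asserted; no count moves; no class booked; NOT refereed; not part of PROOF-B v1.3 or of the paper's claim.

References: [TianYuanZhang2017] §1 (1.1), Thm. 1.1, Thm. 3.5, §3; [HeathBrown1994SelmerCongruentII] Appendix (Monsky), typescript
p. 41 L1–L36 (even case; upper bound a tree theorem); [SilvermanAEC2009] Prop. X.1.4, X.4.9, Thm. X.4.2; [IrelandRosen1990] Ch. 5 §2;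
[Miller2011LMS] Def. 1.1; HOME/proof/PROOF-B-K3-SCOPE.md, PROOF-B-K3-557-note.md.
-/

noncomputable section

open scoped Classical

open Matrix Finset WeierstrassCurve Literature.NumberTheory.EllipticCurves
  Literature.NumberTheory.EllipticCurves.Rank1Residual
  Literature.NumberTheory.EllipticCurves.Rank1Residual.Typed
  Literature.NumberTheory.EllipticCurves.HeathBrown1994
  Literature.NumberTheory.EllipticCurves.HeathBrown1994.Families
  Literature.NumberTheory.EllipticCurves.Tian2014
  Literature.NumberTheory.EllipticCurves.TianYuanZhang2017
  Literature.NumberTheory.EllipticCurves.TianYuanZhang2017.W2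
  Literature.NumberTheory.QuadraticFields.RedeiReichardt

set_option autoImplicit false

namespace Summit.BirchSwinnertonDyer.Rank1Residual.P2

namespace ThetaDescent

variable {p₁ p₂ p₃ : ℕ}

/-! ## §1 Type `(5, 5, 7)` -/

/-- **Type `(5, 5, 7)`, `g(n)` odd, `s(n) = 1`: `ord_{s=1} L = 1`, rank `1`, `Ш[2^∞] = 0`, `BSD(E_n, 2)`** relative to
{`tyz_cmPointGaloisData`, GZK} ONLY — the `2`-Selmer input is the tree's complete `2`-descent. CONDITIONAL; nothing asserted.
[cite: TianYuanZhang2017, §1 (1.1), Thm. 3.5] [cite: HeathBrown1994SelmerCongruentII, Appendix (Monsky), typescript p. 41 L20–L36]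
[cite: SilvermanAEC2009, Prop. X.1.4, Prop. X.4.9, Thm. X.4.2] -/
theorem rankOne_sha_bsdp_two_two_mul_557_of_cmPointGaloisData_descent (hCM : tyz_cmPointGaloisData)
    (hGZK : rank_eq_analyticRank_of_analyticRank_le_one)
    (hp₁ : p₁.Prime) (hp₂ : p₂.Prime) (hp₃ : p₃.Prime) (h₁ : p₁ % 8 = 5) (h₂ : p₂ % 8 = 5) (h₃ : p₃ % 8 = 7)
    (h12 : p₁ ≠ p₂) (hg : Odd (gK (2 * (p₁ * p₂ * p₃)))) (hs : monskySelmerRankEven ![p₁, p₂, p₃] = 1) :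
    (congruentNumberCurve (2 * (p₁ * p₂ * p₃))).analyticRank = 1 ∧
      (congruentNumberCurve (2 * (p₁ * p₂ * p₃))).mordellWeilRank = 1 ∧
      AddCommGroup.primaryComponent (congruentNumberCurve (2 * (p₁ * p₂ * p₃))).sha 2 = ⊥ ∧
      BSDp (congruentNumberCurve (2 * (p₁ * p₂ * p₃))) 2 := by
  have h12m : (p₁ * p₂) % 8 = 1 := by rw [Nat.mul_mod, h₁, h₂]
  have hm7 : (p₁ * p₂ * p₃) % 8 = 7 := by rw [Nat.mul_mod, h12m, h₃]
  have hn6 : (2 * (p₁ * p₂ * p₃)) % 8 = 6 := by omega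
  have h13 : p₁ ≠ p₃ := fun h => by omega
  have h23 : p₂ ≠ p₃ := fun h => by omega
  obtain ⟨-, x, hx0, hv, hx⟩ :=
    rankOneDatum_two_mul_557_of_cmPointGaloisData hCM hGZK hp₁ hp₂ hp₃ h₁ h₂ h₃ h12 hg
  obtain ⟨hr1, hrk, hsha, hiff⟩ :=
    rankOne_sha_bsdp_two_iff_congruentNumberCurve_two_mul_pqr_descent hGZK hp₁ hp₂ hp₃ h12 h13 h23 hn6 hs hx0 hx
  exact ⟨hr1, hrk, hsha, hiff.mpr hv⟩

/-- **The `(5, 5, 7)` family WITHOUT a `2`-Selmer display**: for primes `p₁ ≡ p₂ ≡ 5`, `p₃ ≡ 7 (mod 8)`, `p₁ ≠ p₂`, `(p₁p₂/p₃) = −1`: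
`ord_{s=1} L = 1`, rank `1`, `Ш[2^∞] = 0`, `BSD(E_{2p₁p₂p₃}, 2)`, relative to {`tyz_cmPointGaloisData`, GZK} ONLY.
CONDITIONAL; nothing asserted; closes no class by itself (smallest members `2030`, `8990`).
[cite: TianYuanZhang2017, §1 (1.1), Thm. 3.5, §3] [cite: HeathBrown1994SelmerCongruentII, Appendix (Monsky), typescript p. 41 L20–L36]
[cite: SilvermanAEC2009, Prop. X.1.4, Prop. X.4.9, Thm. X.4.2] -/
theorem rankOne_sha_bsdp_two_two_mul_557_family_descent (hCM : tyz_cmPointGaloisData)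
    (hGZK : rank_eq_analyticRank_of_analyticRank_le_one) :
    ∀ p₁ p₂ p₃ : ℕ, p₁.Prime → p₂.Prime → p₃.Prime → p₁ % 8 = 5 → p₂ % 8 = 5 → p₃ % 8 = 7 → p₁ ≠ p₂ →
      jacobiSym ((p₁ : ℤ) * p₂) p₃ = -1 →
      (congruentNumberCurve (2 * (p₁ * p₂ * p₃))).analyticRank = 1 ∧
        (congruentNumberCurve (2 * (p₁ * p₂ * p₃))).mordellWeilRank = 1 ∧
        AddCommGroup.primaryComponent (congruentNumberCurve (2 * (p₁ * p₂ * p₃))).sha 2 = ⊥ ∧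
        BSDp (congruentNumberCurve (2 * (p₁ * p₂ * p₃))) 2 :=
  fun _ _ _ hp₁ hp₂ hp₃ h₁ h₂ h₃ h12 hj =>
    rankOne_sha_bsdp_two_two_mul_557_of_cmPointGaloisData_descent hCM hGZK hp₁ hp₂ hp₃ h₁ h₂ h₃ h12
      (odd_gK_two_mul_557 hp₁ hp₂ hp₃ h₁ h₂ h₃ h12 hj) (monskySelmerRankEven_557 hp₁ hp₂ hp₃ h₁ h₂ h₃ h12)

/-! ## §2 Type `(3, 7, 7)` -/

/-- **The `(3, 7, 7)` SILENT family WITHOUT a `2`-Selmer display**: for primes `p₁ ≡ 3`, `p₂ ≡ p₃ ≡ 7 (mod 8)`, `p₂ ≠ p₃`,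
`(p₂p₃/p₁) = −1`, `(p₃/p₂) = (p₂/p₁)`: `ord_{s=1} L = 1`, rank `1`, `Ш[2^∞] = 0`, `BSD(E_{2p₁p₂p₃}, 2)`, relative to
{`tyz_cmPointGaloisData`, TYZ Thm. 1.1, GZK} ONLY. CONDITIONAL; nothing asserted; closes no class by itself (smallest members `966`, `4774`).
[cite: TianYuanZhang2017, Thm. 1.1, §1 (1.1), Thm. 3.5, §3] [cite: HeathBrown1994SelmerCongruentII, Appendix (Monsky), typescript p. 41 L20–L36]
[cite: SilvermanAEC2009, Prop. X.1.4, Prop. X.4.9, Thm. X.4.2] -/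
theorem rankOne_sha_bsdp_two_two_mul_377_family_descent (hCM : tyz_cmPointGaloisData) (h11 : thm11_parity_of_scriptL)
    (hGZK : rank_eq_analyticRank_of_analyticRank_le_one) :
    ∀ p₁ p₂ p₃ : ℕ, p₁.Prime → p₂.Prime → p₃.Prime → p₁ % 8 = 3 → p₂ % 8 = 7 → p₃ % 8 = 7 → p₂ ≠ p₃ →
      jacobiSym ((p₂ : ℤ) * p₃) p₁ = -1 → jacobiSym (p₃ : ℤ) p₂ = jacobiSym (p₂ : ℤ) p₁ →
      (congruentNumberCurve (2 * (p₁ * p₂ * p₃))).analyticRank = 1 ∧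
        (congruentNumberCurve (2 * (p₁ * p₂ * p₃))).mordellWeilRank = 1 ∧
        AddCommGroup.primaryComponent (congruentNumberCurve (2 * (p₁ * p₂ * p₃))).sha 2 = ⊥ ∧
        BSDp (congruentNumberCurve (2 * (p₁ * p₂ * p₃))) 2 := by
  intro p₁ p₂ p₃ hp₁ hp₂ hp₃ h₁ h₂ h₃ h23 hj hk
  have h12 : p₁ ≠ p₂ := fun h => by omega
  have h13 : p₁ ≠ p₃ := fun h => by omega
  have h12m : (p₁ * p₂) % 8 = 5 := by rw [Nat.mul_mod, h₁, h₂]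
  have hm3 : (p₁ * p₂ * p₃) % 8 = 3 := by rw [Nat.mul_mod, h12m, h₃]
  have hn6 : (2 * (p₁ * p₂ * p₃)) % 8 = 6 := by omega
  obtain ⟨hbits, hs0⟩ := bits_377_of_jacobiSym hp₁ hp₂ hp₃ h₁ h₂ h₃ h23 hj hk
  have hg : Odd (gK (2 * (p₁ * p₂ * p₃))) := (odd_gK_two_mul_377_iff_bits hp₁ hp₂ hp₃ h₁ h₂ h₃ h23).mpr hbits
  have hs : monskySelmerRankEven ![p₁, p₂, p₃] = 1 := monskySelmerRankEven_377 hp₁ hp₂ hp₃ h₁ h₂ h₃ h23 hs0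
  obtain ⟨-, x, hx0, hv, hx⟩ := rankOneDatum_two_mul_377 hCM h11 hGZK hp₁ hp₂ hp₃ h₁ h₂ h₃ h23 hg
  obtain ⟨hr1, hrk, hsha, hiff⟩ :=
    rankOne_sha_bsdp_two_iff_congruentNumberCurve_two_mul_pqr_descent hGZK hp₁ hp₂ hp₃ h12 h13 h23 hn6 hs hx0 hx
  exact ⟨hr1, hrk, hsha, hiff.mpr hv⟩

/-! ## §3 Type `(3, 5, 5)` -/

/-- **Type `(3, 5, 5)`, `g(n)` odd: `ord_{s=1} L = 1`, rank `1`, `Ш[2^∞] = 0`, `BSD(E_n, 2)`** relative to {`tyz_cmPointGaloisData`,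
TYZ Thm. 1.1, GZK} ONLY (`s(n) = 1` kernel-decided on the type; `#Sel₂ ≤ 8` the tree's `2`-descent). CONDITIONAL; nothing asserted.
[cite: TianYuanZhang2017, §1 (1.1), Thm. 3.5] [cite: HeathBrown1994SelmerCongruentII, Appendix (Monsky), typescript p. 41 L20–L36]
[cite: SilvermanAEC2009, Prop. X.1.4, Prop. X.4.9, Thm. X.4.2] -/
theorem rankOne_sha_bsdp_two_two_mul_355_descent (hCM : tyz_cmPointGaloisData) (h11 : thm11_parity_of_scriptL)
    (hGZK : rank_eq_analyticRank_of_analyticRank_le_one)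
    (hp₁ : p₁.Prime) (hp₂ : p₂.Prime) (hp₃ : p₃.Prime) (h₁ : p₁ % 8 = 3) (h₂ : p₂ % 8 = 5) (h₃ : p₃ % 8 = 5)
    (h23 : p₂ ≠ p₃)
    (hbits : kroneckerBit p₂ p₁ * kroneckerBit p₃ p₁ + kroneckerBit p₂ p₁ * kroneckerBit p₃ p₂ +
      kroneckerBit p₃ p₁ * kroneckerBit p₃ p₂ = 0) :
    (congruentNumberCurve (2 * (p₁ * p₂ * p₃))).analyticRank = 1 ∧
      (congruentNumberCurve (2 * (p₁ * p₂ * p₃))).mordellWeilRank = 1 ∧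
      AddCommGroup.primaryComponent (congruentNumberCurve (2 * (p₁ * p₂ * p₃))).sha 2 = ⊥ ∧
      BSDp (congruentNumberCurve (2 * (p₁ * p₂ * p₃))) 2 := by
  have hn6 := two_mul_355_mod_eight h₁ h₂ h₃
  have h12 : p₁ ≠ p₂ := fun h => by omega
  have h13 : p₁ ≠ p₃ := fun h => by omega
  obtain ⟨-, x, hx0, hv, hx⟩ := rankOneDatum_two_mul_355 hCM h11 hGZK hp₁ hp₂ hp₃ h₁ h₂ h₃ h23 hbits
  obtain ⟨hr1, hrk, hsha, hiff⟩ :=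
    rankOne_sha_bsdp_two_iff_congruentNumberCurve_two_mul_pqr_descent hGZK hp₁ hp₂ hp₃ h12 h13 h23 hn6
      (monskySelmerRankEven_355 hp₁ hp₂ hp₃ h₁ h₂ h₃ h23) hx0 hx
  exact ⟨hr1, hrk, hsha, hiff.mpr hv⟩

/-- **The `(3, 5, 5)` family WITHOUT a `2`-Selmer display**: primes `p₁ ≡ 3`, `p₂ ≡ p₃ ≡ 5 (mod 8)`, `p₂ ≠ p₃`, at least two of
`(p₂/p₁), (p₃/p₁), (p₃/p₂)` equal to `+1`: `ord_{s=1} L = 1`, rank `1`, `Ш[2^∞] = 0`, `BSD(E_{2p₁p₂p₃}, 2)`, relative to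
{`tyz_cmPointGaloisData`, TYZ Thm. 1.1, GZK} ONLY. CONDITIONAL; nothing asserted; closes no class (smallest members `1830`, `2262`).
[cite: TianYuanZhang2017, §1 (1.1), Thm. 1.1, Thm. 3.5, §3] [cite: HeathBrown1994SelmerCongruentII, Appendix (Monsky), typescript p. 41 L20–L36]
[cite: SilvermanAEC2009, Prop. X.1.4, Prop. X.4.9, Thm. X.4.2] -/
theorem rankOne_sha_bsdp_two_two_mul_355_family_descent (hCM : tyz_cmPointGaloisData) (h11 : thm11_parity_of_scriptL)
    (hGZK : rank_eq_analyticRank_of_analyticRank_le_one) :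
    ∀ p₁ p₂ p₃ : ℕ, p₁.Prime → p₂.Prime → p₃.Prime → p₁ % 8 = 3 → p₂ % 8 = 5 → p₃ % 8 = 5 → p₂ ≠ p₃ →
      ((jacobiSym (p₂ : ℤ) p₁ = 1 ∧ jacobiSym (p₃ : ℤ) p₁ = 1) ∨ (jacobiSym (p₂ : ℤ) p₁ = 1 ∧ jacobiSym (p₃ : ℤ) p₂ = 1) ∨
        (jacobiSym (p₃ : ℤ) p₁ = 1 ∧ jacobiSym (p₃ : ℤ) p₂ = 1)) →
      (congruentNumberCurve (2 * (p₁ * p₂ * p₃))).analyticRank = 1 ∧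
        (congruentNumberCurve (2 * (p₁ * p₂ * p₃))).mordellWeilRank = 1 ∧
        AddCommGroup.primaryComponent (congruentNumberCurve (2 * (p₁ * p₂ * p₃))).sha 2 = ⊥ ∧
        BSDp (congruentNumberCurve (2 * (p₁ * p₂ * p₃))) 2 :=
  fun _ _ _ hp₁ hp₂ hp₃ h₁ h₂ h₃ h23 hj =>
    rankOne_sha_bsdp_two_two_mul_355_descent hCM h11 hGZK hp₁ hp₂ hp₃ h₁ h₂ h₃ h23
      (bits_355_of_jacobiSym hp₁ hp₂ hp₃ h₁ h₂ h₃ h23 hj)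

/-! ## §4 Type `(1, 5, 7)` -/

/-- **Type `(1, 5, 7)` with at least two of the three symbols `−1`: `ord_{s=1} L = 1`, rank `1`, `Ш[2^∞] = 0`, `BSD(E_n, 2)`**
relative to {`tyz_cmPointGaloisData`, TYZ Thm. 1.1, GZK} ONLY. CONDITIONAL; nothing asserted.
[cite: TianYuanZhang2017, §1 (1.1), Thm. 3.5] [cite: HeathBrown1994SelmerCongruentII, Appendix (Monsky), typescript p. 41 L20–L36]
[cite: SilvermanAEC2009, Prop. X.1.4, Prop. X.4.9, Thm. X.4.2] -/
theorem rankOne_sha_bsdp_two_two_mul_157_descent (hCM : tyz_cmPointGaloisData) (h11 : thm11_parity_of_scriptL)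
    (hGZK : rank_eq_analyticRank_of_analyticRank_le_one)
    (hp₁ : p₁.Prime) (hp₂ : p₂.Prime) (hp₃ : p₃.Prime) (h₁ : p₁ % 8 = 1) (h₂ : p₂ % 8 = 5) (h₃ : p₃ % 8 = 7)
    (hbits : kroneckerBit p₂ p₁ * kroneckerBit p₃ p₁ + kroneckerBit p₂ p₁ * kroneckerBit p₃ p₂ +
      kroneckerBit p₃ p₁ * kroneckerBit p₃ p₂ = 1) :
    (congruentNumberCurve (2 * (p₁ * p₂ * p₃))).analyticRank = 1 ∧
      (congruentNumberCurve (2 * (p₁ * p₂ * p₃))).mordellWeilRank = 1 ∧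
      AddCommGroup.primaryComponent (congruentNumberCurve (2 * (p₁ * p₂ * p₃))).sha 2 = ⊥ ∧
      BSDp (congruentNumberCurve (2 * (p₁ * p₂ * p₃))) 2 := by
  have hn6 := two_mul_157_mod_eight h₁ h₂ h₃
  have h12 : p₁ ≠ p₂ := fun h => by omega
  have h13 : p₁ ≠ p₃ := fun h => by omega
  have h23 : p₂ ≠ p₃ := fun h => by omega
  have key : ∀ a b c : ZMod 2, a * b + a * c + b * c = 1 → a + b + a * b = 1 := by decide
  have hs := monskySelmerRankEven_157 hp₁ hp₂ hp₃ h₁ h₂ h₃ (key _ _ _ hbits)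
  obtain ⟨-, x, hx0, hv, hx⟩ := rankOneDatum_two_mul_157 hCM h11 hGZK hp₁ hp₂ hp₃ h₁ h₂ h₃ hbits
  obtain ⟨hr1, hrk, hsha, hiff⟩ :=
    rankOne_sha_bsdp_two_iff_congruentNumberCurve_two_mul_pqr_descent hGZK hp₁ hp₂ hp₃ h12 h13 h23 hn6 hs hx0 hx
  exact ⟨hr1, hrk, hsha, hiff.mpr hv⟩

/-- **The `(1, 5, 7)` family WITHOUT a `2`-Selmer display**: primes `p₁ ≡ 1`, `p₂ ≡ 5`, `p₃ ≡ 7 (mod 8)`, at least two of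
`(p₂/p₁), (p₃/p₁), (p₃/p₂)` equal to `−1`: `ord_{s=1} L = 1`, rank `1`, `Ш[2^∞] = 0`, `BSD(E_{2p₁p₂p₃}, 2)`, relative to
{`tyz_cmPointGaloisData`, TYZ Thm. 1.1, GZK} ONLY. CONDITIONAL; nothing asserted; closes no class (smallest members `2870`, `7910`).
[cite: TianYuanZhang2017, §1 (1.1), Thm. 1.1, Thm. 3.5, §3] [cite: HeathBrown1994SelmerCongruentII, Appendix (Monsky), typescript p. 41 L20–L36]
[cite: SilvermanAEC2009, Prop. X.1.4, Prop. X.4.9, Thm. X.4.2] -/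
theorem rankOne_sha_bsdp_two_two_mul_157_family_descent (hCM : tyz_cmPointGaloisData) (h11 : thm11_parity_of_scriptL)
    (hGZK : rank_eq_analyticRank_of_analyticRank_le_one) :
    ∀ p₁ p₂ p₃ : ℕ, p₁.Prime → p₂.Prime → p₃.Prime → p₁ % 8 = 1 → p₂ % 8 = 5 → p₃ % 8 = 7 →
      ((jacobiSym (p₂ : ℤ) p₁ = -1 ∧ jacobiSym (p₃ : ℤ) p₁ = -1) ∨ (jacobiSym (p₂ : ℤ) p₁ = -1 ∧ jacobiSym (p₃ : ℤ) p₂ = -1) ∨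
        (jacobiSym (p₃ : ℤ) p₁ = -1 ∧ jacobiSym (p₃ : ℤ) p₂ = -1)) →
      (congruentNumberCurve (2 * (p₁ * p₂ * p₃))).analyticRank = 1 ∧
        (congruentNumberCurve (2 * (p₁ * p₂ * p₃))).mordellWeilRank = 1 ∧
        AddCommGroup.primaryComponent (congruentNumberCurve (2 * (p₁ * p₂ * p₃))).sha 2 = ⊥ ∧
        BSDp (congruentNumberCurve (2 * (p₁ * p₂ * p₃))) 2 :=
  fun _ _ _ hp₁ hp₂ hp₃ h₁ h₂ h₃ hj =>
    rankOne_sha_bsdp_two_two_mul_157_descent hCM h11 hGZK hp₁ hp₂ hp₃ h₁ h₂ h₃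
      (bits_157_of_jacobiSym hp₁ hp₂ hp₃ h₁ h₂ h₃ hj)

/-! ## §5 Type `(1, 3, 5)` -/

/-- **Type `(1, 3, 5)` with `(p₂/p₁) ≠ (p₃/p₁)`: `ord_{s=1} L = 1`, rank `1`, `Ш[2^∞] = 0`, `BSD(E_n, 2)`** relative to
{`tyz_cmPointGaloisData`, TYZ Thm. 1.1, GZK} ONLY. CONDITIONAL; nothing asserted.
[cite: TianYuanZhang2017, §1 (1.1), Thm. 3.5] [cite: HeathBrown1994SelmerCongruentII, Appendix (Monsky), typescript p. 41 L20–L36]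
[cite: SilvermanAEC2009, Prop. X.1.4, Prop. X.4.9, Thm. X.4.2] -/
theorem rankOne_sha_bsdp_two_two_mul_135_descent (hCM : tyz_cmPointGaloisData) (h11 : thm11_parity_of_scriptL)
    (hGZK : rank_eq_analyticRank_of_analyticRank_le_one)
    (hp₁ : p₁.Prime) (hp₂ : p₂.Prime) (hp₃ : p₃.Prime) (h₁ : p₁ % 8 = 1) (h₂ : p₂ % 8 = 3) (h₃ : p₃ % 8 = 5)
    (hbits : kroneckerBit p₂ p₁ + kroneckerBit p₃ p₁ = 1) :
    (congruentNumberCurve (2 * (p₁ * p₂ * p₃))).analyticRank = 1 ∧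
      (congruentNumberCurve (2 * (p₁ * p₂ * p₃))).mordellWeilRank = 1 ∧
      AddCommGroup.primaryComponent (congruentNumberCurve (2 * (p₁ * p₂ * p₃))).sha 2 = ⊥ ∧
      BSDp (congruentNumberCurve (2 * (p₁ * p₂ * p₃))) 2 := by
  have hn6 := two_mul_135_mod_eight h₁ h₂ h₃
  have h12 : p₁ ≠ p₂ := fun h => by omega
  have h13 : p₁ ≠ p₃ := fun h => by omega
  have h23 : p₂ ≠ p₃ := fun h => by omega
  have key : ∀ a b : ZMod 2, a + b = 1 → a + b + a * b = 1 := by decide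
  have hs := monskySelmerRankEven_135 hp₁ hp₂ hp₃ h₁ h₂ h₃ (key _ _ hbits)
  obtain ⟨-, x, hx0, hv, hx⟩ := rankOneDatum_two_mul_135 hCM h11 hGZK hp₁ hp₂ hp₃ h₁ h₂ h₃ hbits
  obtain ⟨hr1, hrk, hsha, hiff⟩ :=
    rankOne_sha_bsdp_two_iff_congruentNumberCurve_two_mul_pqr_descent hGZK hp₁ hp₂ hp₃ h12 h13 h23 hn6 hs hx0 hx
  exact ⟨hr1, hrk, hsha, hiff.mpr hv⟩

/-- **The `(1, 3, 5)` family WITHOUT a `2`-Selmer display**: primes `p₁ ≡ 1`, `p₂ ≡ 3`, `p₃ ≡ 5 (mod 8)`, `(p₂/p₁) ≠ (p₃/p₁)`: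
`ord_{s=1} L = 1`, rank `1`, `Ш[2^∞] = 0`, `BSD(E_{2p₁p₂p₃}, 2)`, relative to {`tyz_cmPointGaloisData`, TYZ Thm. 1.1, GZK} ONLY.
CONDITIONAL; nothing asserted; closes no class (smallest members `1230`, `2190`).
[cite: TianYuanZhang2017, §1 (1.1), Thm. 1.1, Thm. 3.5, §3] [cite: HeathBrown1994SelmerCongruentII, Appendix (Monsky), typescript p. 41 L20–L36]
[cite: SilvermanAEC2009, Prop. X.1.4, Prop. X.4.9, Thm. X.4.2] -/
theorem rankOne_sha_bsdp_two_two_mul_135_family_descent (hCM : tyz_cmPointGaloisData) (h11 : thm11_parity_of_scriptL)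
    (hGZK : rank_eq_analyticRank_of_analyticRank_le_one) :
    ∀ p₁ p₂ p₃ : ℕ, p₁.Prime → p₂.Prime → p₃.Prime → p₁ % 8 = 1 → p₂ % 8 = 3 → p₃ % 8 = 5 →
      jacobiSym (p₂ : ℤ) p₁ ≠ jacobiSym (p₃ : ℤ) p₁ →
      (congruentNumberCurve (2 * (p₁ * p₂ * p₃))).analyticRank = 1 ∧
        (congruentNumberCurve (2 * (p₁ * p₂ * p₃))).mordellWeilRank = 1 ∧
        AddCommGroup.primaryComponent (congruentNumberCurve (2 * (p₁ * p₂ * p₃))).sha 2 = ⊥ ∧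
        BSDp (congruentNumberCurve (2 * (p₁ * p₂ * p₃))) 2 :=
  fun _ _ _ hp₁ hp₂ hp₃ h₁ h₂ h₃ hj =>
    rankOne_sha_bsdp_two_two_mul_135_descent hCM h11 hGZK hp₁ hp₂ hp₃ h₁ h₂ h₃
      (bits_135_of_jacobiSym hp₁ hp₂ hp₃ h₁ h₂ h₃ hj)

end ThetaDescent

end Summit.BirchSwinnertonDyer.Rank1Residual.P2

end
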